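import Summits.BirchSwinnertonDyer.Rank1Residual.Additive.KatoDescentKatoRigidLayerValues
import Summits.BirchSwinnertonDyer.Rank1Residual.GaloisImage.KatoCharSumFourierInversion
import HarnessLib

set_option autoImplicit false

/-!
# AUG engine, step 2: the level identity of a collinear pair read through Kato's character sums — for every Dirichlet
# character `χ` of `Gal(ℚ_n/ℚ)` and every embedding `ι`: `r_F(χ̄(γ) − 1)·(e • (1 ⊗ Σ_b χ(b)ι(σ_b x₁))) = r_G(χ̄(γ) − 1)·(1 ⊗ Σ_b χ(b)ι(σ_b x₂))`
# in `ℚ_p ⊗_ℚ ℂ` (seat `bsd-cm-prr-ty1` g14, cell `bsd-cm`; theorems only: no definition, no named fact, no instance, no `sorry`)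

Part 44 of the seat's kernel cut of stub 3 (cruxes stmt-BirchSwinnertonDyer-19945 / -19223).  Part 43 (E30
`KatoDescentKatoRigidLayerValues`) proved, for two `ZetaBody` families lifted into one pin with `Λ₂ = e • Λ₁` and a collinearity
`F • y₁ = G • y₂`, the character-free identity `Σ_x τ_{s x}(r_F(τ_γ − 1)(e • (1 ⊗ x₁))) = Σ_x τ_{s x}(r_G(τ_γ − 1)(1 ⊗ x₂))` in
`ℚ_p ⊗ ℚ(ζ_{p^{n+1}})`.  THIS FILE reads it through the `χ`-component functional `ev_{χ,ι} : s ⊗ x ↦ s ⊗ Σ_b χ(b) ι(σ_b x)`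
(`charSum`, Kato Thm. 6.6 (1)) with values in the `ℚ`-algebra `ℚ_p ⊗_ℚ ℂ` — the ring in which a `p`-adic unit `e`, the
`ℤ_p`-coefficients of `r_F, r_G` and the complex periods/`L`-values of the value law (C5) can be compared without choosing
any isomorphism `ℂ ≅ ℚ̄_p`:
* §1 the functional exists (`exists_charSumTensor`, `LinearMap.baseChange` of the `ℚ`-linear `x ↦ charSum m ι χ x`) and is
  characterised by its values on pure tensors (hypothesis `hev` below — any such `ev` will do);
* §2 operator calculus: `ev ∘ τ_σ = (1 ⊗ χ̄(χ_cyc σ)) · ev` (`CharSum.charSum_sigma`), `ev (c • t) = (c ⊗ 1) · ev t` (`c ∈ ℤ_p`),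
  hence `ev ∘ r(τ_γ − 1) = r(u − 1) · ev` with `u = 1 ⊗ χ̄(χ_cyc γ)` (`r` evaluated in the `ℤ_p`-algebra `ℚ_p ⊗ ℂ`), and
  `ev (Σ_x τ_{s x} w) = #(reps) • ev w` when `χ` kills `χ_cyc(s x)` (the characters of `Gal(ℚ_n/ℚ)`);
* §3 ★ `aeval_mul_charSum_eq_of_smul_eq_smul`: under E30's hypotheses and for such `χ`, `ι`:
  **`r_F(u − 1) · (e • (1 ⊗ charSum χ x₁(n+1,𝟙))) = r_G(u − 1) · (1 ⊗ charSum χ x₂(n+1,𝟙))`** in `ℚ_p ⊗_ℚ ℂ`.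
NEXT (not here): the SAME `ι` on both sides vs the families' own `ι₁, ι₂` (`charSum_sigma_of_comp_eq`, the twists `a_m` and
their coherence), the value law (C5) for every Dirichlet character mod `p^{n+1}`, Rohrlich, Weierstrass ⇒ AUG.
HONEST LABEL: theorems about the tree's readings; AUG stays displayed; no stub is closed; nothing is asserted on 19945 / 19223;
Kato's Main Conjecture / Perrin-Riou untouched; BSD is not proved for any curve.
References: [Kato2004Asterisque] Thm. 6.6 (1) (p. 163), §13.8 (p. 228), §13.9 (p. 230), Thm. 12.5 (1) (pp. 221–222);
[Washington1997] §7.1, §13.2.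
-/

noncomputable section

open scoped BigOperators NumberField TensorProduct
open Polynomial Field IsDedekindDomain CongruenceSubgroup
open Literature.NumberTheory.GaloisRepresentations
open Literature.NumberTheory.EllipticCurves Literature.NumberTheory.EllipticCurves.ModularForms
open Literature.NumberTheory.EllipticCurves.Kato2004 Literature.NumberTheory.EllipticCurves.Kato2004.EulerSystemValues
open Rat.HeightOneSpectrum
open Summit.BirchSwinnertonDyer.Rank1Residual.GaloisImage

namespace Summit.BirchSwinnertonDyer.Rank1Residual.Additive.PerrinRiouUnit

/-! ## §1 The `χ`-component functional `ev_{χ,ι}` on `ℚ_p ⊗ ℚ(ζ_m)` -/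

section Functional

variable (p : ℕ) [Fact p.Prime] (m : ℕ) [NeZero m] (ι : CyclotomicField m ℚ →+* ℂ) (χ : DirichletCharacter ℂ m)

/-- **The `χ`-component functional exists**: a `ℚ_p`-linear `ev : ℚ_p ⊗ ℚ(ζ_m) → ℚ_p ⊗_ℚ ℂ` with
`ev (s ⊗ x) = s ⊗ Σ_b χ(b) ι(σ_b x)` (base change of the `ℚ`-linear `x ↦ charSum m ι χ x`).
[cite: Kato2004Asterisque, Thm. 6.6 (1) (p. 163) and Thm. 12.5 (1) (pp. 221–222)] -/
theorem exists_charSumTensor :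
    ∃ ev : ℚ_[p] ⊗[ℚ] CyclotomicField m ℚ →ₗ[ℚ_[p]] ℚ_[p] ⊗[ℚ] ℂ,
      ∀ (s : ℚ_[p]) (x : CyclotomicField m ℚ), ev (s ⊗ₜ[ℚ] x) = s ⊗ₜ[ℚ] charSum m ι χ x := by
  let cs : CyclotomicField m ℚ →ₗ[ℚ] ℂ :=
    { toFun := charSum m ι χ
      map_add' := CharSum.charSum_add m ι χ
      map_smul' := fun q x => by rw [CharSum.charSum_smul, RingHom.id_apply, Rat.smul_def] }
  exact ⟨cs.baseChange ℚ_[p], fun s x => by rw [LinearMap.baseChange_tmul]; rfl⟩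

end Functional


/-! ## §2 Operator calculus of `ev_{χ,ι}` -/

section Calculus

variable {p : ℕ} [Fact p.Prime] {m : ℕ} [NeZero m] {ι : CyclotomicField m ℚ →+* ℂ} {χ : DirichletCharacter ℂ m}
  {ev : ℚ_[p] ⊗[ℚ] CyclotomicField m ℚ →ₗ[ℚ_[p]] ℚ_[p] ⊗[ℚ] ℂ}
  (hev : ∀ (s : ℚ_[p]) (x : CyclotomicField m ℚ), ev (s ⊗ₜ[ℚ] x) = s ⊗ₜ[ℚ] charSum m ι χ x)
include hev

/-- `ev ∘ (1 ⊗ σ_c) = (1 ⊗ χ̄(c)) · ev` (`CharSum.charSum_sigma`: `Σ_b χ(b)ι(σ_bσ_c x) = χ̄(c) Σ_b χ(b)ι(σ_b x)`).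
[cite: Kato2004Asterisque, Thm. 6.6 (1) (p. 163)] -/
theorem charSumTensor_map_sigma (c : (ZMod m)ˣ) (t : ℚ_[p] ⊗[ℚ] CyclotomicField m ℚ) :
    ev (Algebra.TensorProduct.map (AlgHom.id ℚ ℚ_[p]) (sigma m c : CyclotomicField m ℚ →ₐ[ℚ] CyclotomicField m ℚ) t) =
      ((1 : ℚ_[p]) ⊗ₜ[ℚ] χ⁻¹ (c : ZMod m)) * ev t := by
  induction t using TensorProduct.induction_on with
  | zero => rw [map_zero, map_zero, mul_zero]
  | tmul s x =>
    rw [Algebra.TensorProduct.map_tmul, AlgHom.id_apply, AlgEquiv.coe_toAlgHom, hev, hev, CharSum.charSum_sigma,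
      Algebra.TensorProduct.tmul_mul_tmul, one_mul]
  | add t₁ t₂ h₁ h₂ => rw [map_add, map_add, h₁, h₂, map_add, mul_add]

omit [NeZero m] hev in
/-- `ev (c • t) = (c ⊗ 1) · ev t` for `c ∈ ℤ_p`. [folklore] -/
theorem charSumTensor_smul_padicInt (c : ℤ_[p]) (t : ℚ_[p] ⊗[ℚ] CyclotomicField m ℚ) :
    ev (c • t) = (((c : ℚ_[p])) ⊗ₜ[ℚ] (1 : ℂ)) * ev t := by
  rw [show c • t = (c : ℚ_[p]) • t from rfl, map_smul, Algebra.smul_def, Algebra.TensorProduct.algebraMap_apply,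
    Algebra.algebraMap_self, RingHom.id_apply]

omit [NeZero m] hev in
/-- `ev ∘ r(T − 1) = r(u − 1) · ev` for an endomorphism `T` with `ev ∘ T = u · ev` (`r ∈ ℤ_p[X]` evaluated in the
`ℤ_p`-algebra `ℚ_p ⊗_ℚ ℂ`). [folklore] -/
theorem charSumTensor_aeval {T : Module.End ℤ_[p] (ℚ_[p] ⊗[ℚ] CyclotomicField m ℚ)} {u : ℚ_[p] ⊗[ℚ] ℂ}
    (hT : ∀ t, ev (T t) = u * ev t) (r : ℤ_[p][X]) (t : ℚ_[p] ⊗[ℚ] CyclotomicField m ℚ) :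
    ev (aeval (T - 1) r t) = aeval (u - 1) r * ev t := by
  induction r using Polynomial.induction_on generalizing t with
  | C c =>
    rw [aeval_C, Module.algebraMap_end_apply, charSumTensor_smul_padicInt, aeval_C,
      Algebra.TensorProduct.algebraMap_apply]
    rfl
  | add f g hf hg => rw [map_add, LinearMap.add_apply, map_add, hf, hg, map_add, add_mul]
  | monomial k c hk =>
    rw [pow_succ, ← mul_assoc, map_mul (aeval (T - 1)), aeval_X, Module.End.mul_apply, hk, LinearMap.sub_apply, map_sub, hT,
      Module.End.one_apply, map_mul (aeval (u - 1)) (C c * Polynomial.X ^ k) Polynomial.X, aeval_X]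
    ring

/-- `ev (Σ_x τ_{s x} w) = #(reps) • ev w` when `τ` realises the twists and `χ` kills every `χ_cyc(s x)`. [cite: Kato2004Asterisque, §13.8 (p. 228)] -/
theorem charSumTensor_sum_twist {α : Type*} [Fintype α] (τ : absoluteGaloisGroup ℚ → Module.End ℤ_[p] (ℚ_[p] ⊗[ℚ] CyclotomicField m ℚ))
    (hτ : ∀ (σ : absoluteGaloisGroup ℚ) (t : ℚ_[p] ⊗[ℚ] CyclotomicField m ℚ),
      τ σ t = Algebra.TensorProduct.map (AlgHom.id ℚ ℚ_[p])
        (sigma m (modNCyclotomicCharacter ℚ m σ) : CyclotomicField m ℚ →ₐ[ℚ] CyclotomicField m ℚ) t)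
    (g : α → absoluteGaloisGroup ℚ) (hg : ∀ a, χ ((modNCyclotomicCharacter ℚ m (g a) : (ZMod m)ˣ) : ZMod m) = 1)
    (w : ℚ_[p] ⊗[ℚ] CyclotomicField m ℚ) :
    ev (∑ a, τ (g a) w) = Fintype.card α • ev w := by
  rw [map_sum]
  have h1 : ∀ a, ev (τ (g a) w) = ev w := fun a => by
    rw [hτ, charSumTensor_map_sigma hev, MulChar.inv_apply_eq_inv', hg, inv_one, ← Algebra.TensorProduct.one_def, one_mul]
  simp_rw [h1]
  rw [Finset.sum_const, Finset.card_univ]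

end Calculus


/-! ## §3 The level identity through `ev_{χ,ι}` -/

section Main

variable {W : WeierstrassCurve ℚ} [W.IsElliptic] {p : ℕ} [Fact p.Prime] [ContinuousSMul ℤ_[p] (W.tateModule p)]
  [Module.Free ℤ_[p] (W.tateModule p)] [Module.Finite ℤ_[p] (W.tateModule p)]
  {N : ℕ} {f : CuspForm (Gamma0 N) 2} {ι₁ ι₂ : (m : ℕ) → (CyclotomicField m ℚ →+* ℂ)} {κ₁ κ₂ : ℝ}
  {Λ₁ Λ₂ : ∀ (k : ℕ) (r : Finset (HeightOneSpectrum (𝓞 ℚ))),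
    H1 (tateRep W p) (cycSubgroup p k r) →ₗ[ℤ_[p]] ℚ_[p] ⊗[ℚ] CyclotomicField (cycLevel p k r) ℚ}
  {c₁ d₁ a₁ : ℤ} {A₁ : ℕ} {c₂ d₂ a₂ : ℤ} {A₂ : ℕ}
  {z₁ : ∀ (k : ℕ) (r : (cyclotomicLevelsRat p (badPlaces c₁ d₁ A₁ N)).Ideals),
    H1 (tateRep W p) ((cyclotomicLevelsRat p (badPlaces c₁ d₁ A₁ N)).level k r.1)}
  {x₁ : ∀ (k : ℕ) (r : (cyclotomicLevelsRat p (badPlaces c₁ d₁ A₁ N)).Ideals), CyclotomicField (cycLevel p k r.1) ℚ}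
  {z₂ : ∀ (k : ℕ) (r : (cyclotomicLevelsRat p (badPlaces c₂ d₂ A₂ N)).Ideals),
    H1 (tateRep W p) ((cyclotomicLevelsRat p (badPlaces c₂ d₂ A₂ N)).level k r.1)}
  {x₂ : ∀ (k : ℕ) (r : (cyclotomicLevelsRat p (badPlaces c₂ d₂ A₂ N)).Ideals), CyclotomicField (cycLevel p k r.1) ℚ}
  {K : ZpExtension ℚ p} {γ : absoluteGaloisGroup ℚ}

/-- **The level identity of a collinear pair, read through a character of `Gal(ℚ_n/ℚ)`.**  Under the hypotheses of E30
`sum_twist_aeval_eq_of_smul_eq_smul` (two `ZetaBody` families of one newform in one pin, `Λ₂ = e • Λ₁` on level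
`p^{n+1}`, `F • y₁ = G • y₂`, `r_F ≡ F`, `r_G ≡ G mod ω_n`), for every Dirichlet character `χ mod p^{n+1}` killing
`χ_cyc(Gal(ℚ̄/ℚ_n))`, every embedding `ι` and every `χ`-component functional `ev` (§1):
`r_F(u − 1)·(e • (1 ⊗ charSum χ x₁(n+1,𝟙))) = r_G(u − 1)·(1 ⊗ charSum χ x₂(n+1,𝟙))` in `ℚ_p ⊗_ℚ ℂ`, `u = 1 ⊗ χ̄(χ_cyc γ)`.
(E30 + §2; the `p − 1 = #Gal(ℚ(μ_{p^{n+1}})/ℚ_n)` copies cancel in characteristic `0`.)  Nothing about Kato's classes is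
asserted. [cite: Kato2004Asterisque, §13.8 (p. 228), §13.9 (p. 230), Thm. 12.5 (1) (pp. 221–222)] -/
theorem aeval_mul_charSum_eq_of_smul_eq_smul (hb₁ : ZetaBody W p f ι₁ κ₁ Λ₁ c₁ d₁ a₁ A₁ z₁ x₁)
    (hb₂ : ZetaBody W p f ι₂ κ₂ Λ₂ c₂ d₂ a₂ A₂ z₂ x₂) (hK : K.IsCyclotomic) (hp : p ≠ 2) (hγ : K.IsTopGenerator γ)
    (I : IwasawaH1Data W p K γ) (n : ℕ) {y₁ y₂ : I.H}
    (hy₁ : I.proj n y₁ = levelToLayer W p hK hp (badPlaces c₁ d₁ A₁ N) n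
      (z₁ (n + 1) (cyclotomicLevelsRat p (badPlaces c₁ d₁ A₁ N)).idealOne))
    (hy₂ : I.proj n y₂ = levelToLayer W p hK hp (badPlaces c₂ d₂ A₂ N) n
      (z₂ (n + 1) (cyclotomicLevelsRat p (badPlaces c₂ d₂ A₂ N)).idealOne))
    {e : ℚ_[p]} (hΛ : ∀ y : H1 (tateRep W p) (cycSubgroup p (n + 1) ∅), Λ₂ (n + 1) ∅ y = e • Λ₁ (n + 1) ∅ y)
    {F G : IwasawaAlgebra p} {rF rG : ℤ_[p][X]}
    (hF : F - (rF : PowerSeries ℤ_[p]) ∈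
      Ideal.span {(((Polynomial.X + 1 : ℤ_[p][X]) ^ p ^ n - 1 : ℤ_[p][X]) : PowerSeries ℤ_[p])})
    (hG : G - (rG : PowerSeries ℤ_[p]) ∈
      Ideal.span {(((Polynomial.X + 1 : ℤ_[p][X]) ^ p ^ n - 1 : ℤ_[p][X]) : PowerSeries ℤ_[p])})
    (hFG : F • y₁ = G • y₂)
    (χ : DirichletCharacter ℂ (cycLevel p (n + 1) ∅))
    (hχ : ∀ σ ∈ K.layerSubgroup n,
      χ ((modNCyclotomicCharacter ℚ (cycLevel p (n + 1) ∅) σ : (ZMod (cycLevel p (n + 1) ∅))ˣ) :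
        ZMod (cycLevel p (n + 1) ∅)) = 1)
    (ι : CyclotomicField (cycLevel p (n + 1) ∅) ℚ →+* ℂ)
    {ev : ℚ_[p] ⊗[ℚ] CyclotomicField (cycLevel p (n + 1) ∅) ℚ →ₗ[ℚ_[p]] ℚ_[p] ⊗[ℚ] ℂ}
    (hev : ∀ (s : ℚ_[p]) (x : CyclotomicField (cycLevel p (n + 1) ∅) ℚ),
      ev (s ⊗ₜ[ℚ] x) = s ⊗ₜ[ℚ] charSum (cycLevel p (n + 1) ∅) ι χ x) :
    aeval (((1 : ℚ_[p]) ⊗ₜ[ℚ] χ⁻¹ ((modNCyclotomicCharacter ℚ (cycLevel p (n + 1) ∅) γ : (ZMod (cycLevel p (n + 1) ∅))ˣ) :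
        ZMod (cycLevel p (n + 1) ∅)) : ℚ_[p] ⊗[ℚ] ℂ) - 1) rF *
        (e • ((1 : ℚ_[p]) ⊗ₜ[ℚ] charSum (cycLevel p (n + 1) ∅) ι χ (x₁ (n + 1) (cyclotomicLevelsRat p (badPlaces c₁ d₁ A₁ N)).idealOne))) =
      aeval (((1 : ℚ_[p]) ⊗ₜ[ℚ] χ⁻¹ ((modNCyclotomicCharacter ℚ (cycLevel p (n + 1) ∅) γ : (ZMod (cycLevel p (n + 1) ∅))ˣ) :
        ZMod (cycLevel p (n + 1) ∅)) : ℚ_[p] ⊗[ℚ] ℂ) - 1) rG *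
        ((1 : ℚ_[p]) ⊗ₜ[ℚ] charSum (cycLevel p (n + 1) ∅) ι χ (x₂ (n + 1) (cyclotomicLevelsRat p (badPlaces c₂ d₂ A₂ N)).idealOne)) := by
  letI : Fintype (K.layerSubgroup n ⧸ (cycSubgroup p (n + 1) ∅).subgroupOf (K.layerSubgroup n)) := Fintype.ofFinite _
  -- the twist family and E30's level identity
  obtain ⟨τ, hτ⟩ := exists_twistEnd p (cycLevel p (n + 1) ∅)
  have hs : ∀ x : K.layerSubgroup n ⧸ (cycSubgroup p (n + 1) ∅).subgroupOf (K.layerSubgroup n),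
      ((Quotient.out x : K.layerSubgroup n) : K.layerSubgroup n ⧸ (cycSubgroup p (n + 1) ∅).subgroupOf (K.layerSubgroup n)) = x :=
    fun x => QuotientGroup.out_eq' x
  have h5 := sum_twist_aeval_eq_of_smul_eq_smul hb₁ hb₂ hK hp hγ I n hy₁ hy₂ hΛ τ hτ hs hF hG hFG
  -- apply `ev`
  have hγ' : ∀ t, ev (τ γ t) = ((1 : ℚ_[p]) ⊗ₜ[ℚ] χ⁻¹ ((modNCyclotomicCharacter ℚ (cycLevel p (n + 1) ∅) γ :
      (ZMod (cycLevel p (n + 1) ∅))ˣ) : ZMod (cycLevel p (n + 1) ∅))) * ev t := fun t => by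
    rw [hτ, charSumTensor_map_sigma hev]
  have hA : ev (e • ((1 : ℚ_[p]) ⊗ₜ[ℚ] (x₁ (n + 1) (cyclotomicLevelsRat p (badPlaces c₁ d₁ A₁ N)).idealOne :
      CyclotomicField (cycLevel p (n + 1) ∅) ℚ))) =
      e • ((1 : ℚ_[p]) ⊗ₜ[ℚ] charSum (cycLevel p (n + 1) ∅) ι χ
        (x₁ (n + 1) (cyclotomicLevelsRat p (badPlaces c₁ d₁ A₁ N)).idealOne)) := by
    exact (map_smul ev e _).trans (congrArg (e • ·) (hev 1 _))
  have hB : ev ((1 : ℚ_[p]) ⊗ₜ[ℚ] (x₂ (n + 1) (cyclotomicLevelsRat p (badPlaces c₂ d₂ A₂ N)).idealOne :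
      CyclotomicField (cycLevel p (n + 1) ∅) ℚ)) =
      (1 : ℚ_[p]) ⊗ₜ[ℚ] charSum (cycLevel p (n + 1) ∅) ι χ (x₂ (n + 1) (cyclotomicLevelsRat p (badPlaces c₂ d₂ A₂ N)).idealOne) :=
    hev 1 _
  have h6 : Fintype.card (K.layerSubgroup n ⧸ (cycSubgroup p (n + 1) ∅).subgroupOf (K.layerSubgroup n)) •
      (aeval (((1 : ℚ_[p]) ⊗ₜ[ℚ] χ⁻¹ ((modNCyclotomicCharacter ℚ (cycLevel p (n + 1) ∅) γ :
          (ZMod (cycLevel p (n + 1) ∅))ˣ) : ZMod (cycLevel p (n + 1) ∅)) : ℚ_[p] ⊗[ℚ] ℂ) - 1) rF *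
        (e • ((1 : ℚ_[p]) ⊗ₜ[ℚ] charSum (cycLevel p (n + 1) ∅) ι χ
          (x₁ (n + 1) (cyclotomicLevelsRat p (badPlaces c₁ d₁ A₁ N)).idealOne)))) =
      Fintype.card (K.layerSubgroup n ⧸ (cycSubgroup p (n + 1) ∅).subgroupOf (K.layerSubgroup n)) •
      (aeval (((1 : ℚ_[p]) ⊗ₜ[ℚ] χ⁻¹ ((modNCyclotomicCharacter ℚ (cycLevel p (n + 1) ∅) γ :
          (ZMod (cycLevel p (n + 1) ∅))ˣ) : ZMod (cycLevel p (n + 1) ∅)) : ℚ_[p] ⊗[ℚ] ℂ) - 1) rG *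
        ((1 : ℚ_[p]) ⊗ₜ[ℚ] charSum (cycLevel p (n + 1) ∅) ι χ
          (x₂ (n + 1) (cyclotomicLevelsRat p (badPlaces c₂ d₂ A₂ N)).idealOne))) := by
    have h := congrArg ev h5
    rw [charSumTensor_sum_twist hev τ hτ _ (fun x => hχ _ (Quotient.out x).2),
      charSumTensor_sum_twist hev τ hτ _ (fun x => hχ _ (Quotient.out x).2),
      charSumTensor_aeval hγ', charSumTensor_aeval hγ'] at h
    rw [← hA, ← hB]
    exact h
  -- cancel `#(reps) ≠ 0` (characteristic zero)
  have hcard : (Fintype.card (K.layerSubgroup n ⧸ (cycSubgroup p (n + 1) ∅).subgroupOf (K.layerSubgroup n))) ≠ 0 :=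
    Fintype.card_ne_zero
  rw [← Nat.cast_smul_eq_nsmul ℚ, ← Nat.cast_smul_eq_nsmul ℚ] at h6
  exact smul_right_injective _ (Nat.cast_ne_zero.mpr hcard) h6

end Main

end Summit.BirchSwinnertonDyer.Rank1Residual.Additive.PerrinRiouUnit

end
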